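import Mathlib.Algebra.BigOperators.Fin
import Literature.Computability.Complexity.PEASigmaTwoProgram
import Literature.Computability.Complexity.BitFormats
import Literature.Computability.Complexity.PostBPPHashCriterion
import HarnessLib

/-!
# Entropy approximation in `Σ₂ᵖ`, VI: the program decides Sipser's `Separate` predicate

Sixth file of the proof of `PEA d ∈ promiseLift (SigmaP 2)` (program: `PEASigmaTwoProgram.lean`).
The matrix `PEAHash.matCore Q n' k h v u` reads the strings `h, v, u` through zero-padded windows;
this file identifies those reads with Boolean vectors and proves

* list/vector bridges: `sliceD_eq_ofFn`, `sliceD_ofFn`, `dotB_ofFn` (`= ⟨·,·⟩` over `F₂`),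
  `evalMap_sliceD_ofFn`, `relOK_ofFn_iff` and `exists_relOK_iff_mem_npSet`
  (the `P`-relation is membership in `S = npSet Q n' k`), `notInX_ofFn_iff`;
* `matCore_eq_true_iff` — the matrix, decoded;
* **`matCore_of_hashable`** — if the `t`-fold power `S^t` is hashable at level `κ`, the string `h`
  listing a separating family makes the matrix true for ALL `v, u`;
* **`hashable_of_matCore`** — conversely, if some `h` makes the matrix true for all `v, u` of the
  lengths of an encoded challenge `(y, Z_0, …, Z_{κ-1})` and of an encoded witness table, then `S^t`
  is hashable at level `κ` (a non-isolated `y` and its colliders, with membership witnesses, would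
  refute it);
* `matCore_eq_false_of_le` — the guard `k < n'`.

## References

* M. Sipser, *A complexity theoretic approach to randomness*, STOC 1983, §III (Coding Lemma), §V.
* Y. Han, L. A. Hemaspaandra, T. Thierauf, SIAM J. Comput. 26 (1997), Thm. 3.11 (the skolemised
  `Separate` predicate as a `Σ₂ᵖ` matrix).
-/

namespace Literature.Computability.Complexity

open Finset Blocks SipserHash PostBPPHash

namespace PEAHash

/-! ### Windows of strings as vectors -/

section ListVec

variable {m : ℕ}

/-- `takeD` with default `false` is the `ofFn` of the padded reads. [folklore] -/
theorem takeD_false_eq_ofFn : ∀ (len : ℕ) (l : List Bool),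
    l.takeD len false = List.ofFn fun c : Fin len => l.getD c false
  | 0, l => by simp
  | len + 1, l => by
    rw [List.takeD_succ, List.ofFn_succ, takeD_false_eq_ofFn len l.tail]
    cases l with
    | nil => simp
    | cons b l => simp

/-- **A window is the `ofFn` of its padded reads.** [folklore] -/
theorem sliceD_eq_ofFn (s : List Bool) (off len : ℕ) :
    sliceD s off len = List.ofFn fun c : Fin len => s.getD (off + c) false := by
  unfold sliceD
  rw [takeD_false_eq_ofFn]
  congr 1
  funext c
  rw [List.getD_eq_getElem?_getD, List.getD_eq_getElem?_getD, List.getElem?_drop]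

/-- Reading the list of a vector is `vget`. [folklore] -/
theorem getD_ofFn_eq_vget (w : Fin m → Bool) (i : ℕ) : (List.ofFn w).getD i false = vget w i := by
  unfold vget
  split_ifs with h
  · exact getD_ofFn w false h
  · rw [List.getD_eq_default]; simpa using not_lt.1 h

/-- A window of the list of a vector is the list of the vector window. [folklore] -/
theorem sliceD_ofFn (w : Fin m → Bool) (off len : ℕ) : sliceD (List.ofFn w) off len = List.ofFn (vslice w off len) := by
  rw [sliceD_eq_ofFn]
  congr 1
  funext c
  rw [getD_ofFn_eq_vget]; rfl

/-- The block windows of a tupled vector are its blocks. [folklore] -/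
theorem vslice_eq_blk {t : ℕ} (w : Fin (t * m) → Bool) (j : Fin t) : vslice w (j * m) m = blk w j := by
  funext c
  simp only [vslice, blk]
  have h : (j : ℕ) * m + c < t * m := blockIndex_lt c.isLt j.isLt
  rw [vget, dif_pos h]
  congr 1
  exact Fin.ext (by simp [blkIx_val])

/-- `zipWith` of two `ofFn` of the same length. [folklore] -/
theorem zipWith_ofFn {α β γ : Type*} (f : α → β → γ) (a : Fin m → α) (b : Fin m → β) :
    List.zipWith f (List.ofFn a) (List.ofFn b) = List.ofFn fun i => f (a i) (b i) := by
  apply List.ext_getElem (by simp)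
  intro i h₁ h₂
  simp [List.getElem_zipWith]

/-- **The program's inner product is the `F₂` inner product**: `[dotB a w] = ⟨a, w⟩`. [cite: HanHemaspaandraThierauf1997, Def. 3.8] -/
theorem ite_dotB_ofFn (a w : Fin m → Bool) :
    (if dotB (List.ofFn a) (List.ofFn w) then (1 : ZMod 2) else 0) = dotZ a w := by
  unfold dotB dotZ
  rw [zipWith_ofFn]
  -- xor-fold = sum in `ZMod 2`
  have key : ∀ (l : List Bool) (b : Bool), (if l.foldl (fun acc c => (acc ^^ c)) b then (1 : ZMod 2) else 0) =
      (if b then 1 else 0) + (l.map fun c => if c then (1 : ZMod 2) else 0).sum := by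
    intro l
    induction l with
    | nil => intro b; simp
    | cons c l ih =>
      intro b
      rw [List.foldl_cons, ih, List.map_cons, List.sum_cons, ← add_assoc]
      congr 1
      cases b <;> cases c <;> decide
  rw [key, if_neg (by decide), zero_add, List.map_ofFn, List.sum_ofFn]
  rfl

/-- `dotB a w = b ↔ ⟨a, w⟩ = [b]`. [cite: HanHemaspaandraThierauf1997, Def. 3.8] -/
theorem dotB_ofFn_eq_iff (a w : Fin m → Bool) (b : Bool) :
    dotB (List.ofFn a) (List.ofFn w) = b ↔ dotZ a w = if b then 1 else 0 := by
  rw [← ite_dotB_ofFn]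
  cases hd : dotB (List.ofFn a) (List.ofFn w) <;> cases b <;> simp

/-- Two windows have different inner products with a row iff the `F₂` products differ. [folklore] -/
theorem dotB_ofFn_ne_iff (a z y : Fin m → Bool) :
    (dotB (List.ofFn a) (List.ofFn z) != dotB (List.ofFn a) (List.ofFn y)) = true ↔ dotZ a z ≠ dotZ a y := by
  rw [← ite_dotB_ofFn, ← ite_dotB_ofFn]
  cases dotB (List.ofFn a) (List.ofFn z) <;> cases dotB (List.ofFn a) (List.ofFn y) <;> simp

end ListVec

/-! ### The relation is membership in `S` -/

section Rel

variable (Q : List (List (List ℕ))) (n' k : ℕ)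

/-- Evaluating the map on a block window of a sample vector. [folklore] -/
theorem evalMap_sliceD_ofFn {T : ℕ} (w : Fin (T * n') → Bool) (i : Fin T) :
    evalMap Q (sliceD (List.ofFn w) (i * n') n') = evalV Q n' (blk w i) := by
  rw [sliceD_ofFn, vslice_eq_blk]; rfl

/-- `fibOK` decoded: blockwise equal values. [cite: DvirGutfreundRothblumVadhan2010, §3 p.6] -/
theorem fibOK_ofFn_iff {T : ℕ} (x w : Fin (T * n') → Bool) :
    fibOK Q n' T (List.ofFn x) (List.ofFn w) = true ↔ ∀ i : Fin T, evalV Q n' (blk w i) = evalV Q n' (blk x i) := by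
  unfold fibOK
  simp only [List.all_eq_true, List.mem_range, beq_iff_eq]
  constructor
  · intro h i
    have := h i i.isLt
    rwa [evalMap_sliceD_ofFn, evalMap_sliceD_ofFn] at this
  · intro h i hi
    have := h ⟨i, hi⟩
    rw [← evalMap_sliceD_ofFn, ← evalMap_sliceD_ofFn] at this
    exact this

/-- `hashOK` decoded: `A w = b` row by row. [cite: Sipser1983, §III] -/
theorem hashOK_ofFn_iff {M N r : ℕ} (s : Fin M → Bool) (w : Fin N → Bool) :
    hashOK N r (List.ofFn s) (List.ofFn w) = true ↔
      ∀ ρ : Fin r, dotZ (vslice s (N + ρ * N) N) w = if vget s (N + r * N + ρ) then 1 else 0 := by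
  unfold hashOK
  simp only [List.all_eq_true, List.mem_range, beq_iff_eq, sliceD_ofFn, getD_ofFn_eq_vget]
  constructor
  · intro h ρ
    exact (dotB_ofFn_eq_iff _ _ _).1 (h ρ ρ.isLt)
  · intro h ρ hρ
    exact (dotB_ofFn_eq_iff _ _ _).2 (h ⟨ρ, hρ⟩)

/-- **`relOK` decoded** on an `M`-bit vector `s` and a witness vector `w`: the defining relation of
`npSet`. [cite: Sipser1983, §III] -/
theorem relOK_ofFn_iff (s : Fin (pM n' k) → Bool) (w : Fin (pT n' * n') → Bool) :
    relOK Q n' (pT n') (pN n') (pR n' k) (List.ofFn s) (List.ofFn w) = true ↔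
      (∀ i : Fin (pT n'), evalV Q n' (blk w i) = evalV Q n' (blk (vslice s 0 (pT n' * n')) i)) ∧
        ∀ ρ : Fin (pR n' k), dotZ (vslice s (pN n' + ρ * pN n') (pT n' * n')) w =
          if vget s (pN n' + pR n' k * pN n' + ρ) then 1 else 0 := by
  unfold relOK
  rw [Bool.and_eq_true, sliceD_ofFn, fibOK_ofFn_iff, hashOK_ofFn_iff]

/-- **Witnessed membership is membership in `S`.** [cite: Sipser1983, §III] -/
theorem exists_relOK_iff_mem_npSet (s : Fin (pM n' k) → Bool) :
    (∃ w : Fin (pT n' * n') → Bool, relOK Q n' (pT n') (pN n') (pR n' k) (List.ofFn s) (List.ofFn w) = true) ↔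
      s ∈ npSet Q n' k := by
  classical
  unfold npSet
  simp only [mem_filter, mem_univ, true_and, relOK_ofFn_iff]

/-- **`notInX` decoded**: some block of the side vector is not witnessed by the corresponding window
of `u`. [cite: Sipser1983, §V] -/
theorem notInX_ofFn_iff (Sv : Fin (pt n' k * pM n' k) → Bool) (u : List Bool) (c : ℕ) :
    notInX Q n' (pT n') (pN n') (pR n' k) (pM n' k) (pt n' k) (List.ofFn Sv) u c = true ↔
      ∃ j : Fin (pt n' k), relOK Q n' (pT n') (pN n') (pR n' k) (List.ofFn (blk Sv j))
        (List.ofFn fun e : Fin (pT n' * n') => u.getD ((c * pt n' k + j) * pN n' + e) false) = false := by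
  unfold notInX
  simp only [List.any_eq_true, List.mem_range, Bool.not_eq_true', sliceD_ofFn, sliceD_eq_ofFn u]
  constructor
  · rintro ⟨j, hj, h⟩
    have e : vslice Sv (j * pM n' k) (pM n' k) = blk Sv ⟨j, hj⟩ := vslice_eq_blk Sv ⟨j, hj⟩
    rw [e] at h
    exact ⟨⟨j, hj⟩, h⟩
  · rintro ⟨j, h⟩
    have e : vslice Sv (j * pM n' k) (pM n' k) = blk Sv j := vslice_eq_blk Sv j
    rw [← e] at h
    exact ⟨j, j.isLt, h⟩

end Rel

/-! ### The matrix, decoded -/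

section Matrix

variable (Q : List (List (List ℕ))) (n' k : ℕ)

/-- **The matrix decoded.** With `y = v[0, L)`, `Z_a = v[(a+1)L, +L)`, `H a ρ = h[(aκ+ρ)L, +L)` and the
witness windows of `u`: `matCore = true` iff `k < n'` and (`y` is refuted, or some `a < κ` has `Z_a`
refuted or `Z_a = y` or a row of `H a` telling `Z_a` and `y` apart). [cite: Sipser1983, §V]
[cite: HanHemaspaandraThierauf1997, Thm. 3.11 (proof)] -/
theorem matCore_eq_true_iff (h v u : List Bool) :
    matCore Q n' k h v u = true ↔ k < n' ∧
      ((∃ j : Fin (pt n' k), relOK Q n' (pT n') (pN n') (pR n' k)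
          (List.ofFn (blk (fun e : Fin (pt n' k * pM n' k) => v.getD (0 + e) false) j))
          (List.ofFn fun e : Fin (pT n' * n') => u.getD ((0 * pt n' k + j) * pN n' + e) false) = false) ∨
        ∃ a : Fin (pK n' k),
          (∃ j : Fin (pt n' k), relOK Q n' (pT n') (pN n') (pR n' k)
              (List.ofFn (blk (fun e : Fin (pt n' k * pM n' k) => v.getD ((a + 1) * pL n' k + e) false) j))
              (List.ofFn fun e : Fin (pT n' * n') => u.getD (((a + 1) * pt n' k + j) * pN n' + e) false) = false) ∨
          (fun e : Fin (pt n' k * pM n' k) => v.getD ((a + 1) * pL n' k + e) false) =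
              (fun e : Fin (pt n' k * pM n' k) => v.getD (0 + e) false) ∨
          ∃ ρ : Fin (pK n' k),
            dotZ (fun e : Fin (pt n' k * pM n' k) => h.getD ((a * pK n' k + ρ) * pL n' k + e) false)
                (fun e : Fin (pt n' k * pM n' k) => v.getD ((a + 1) * pL n' k + e) false) ≠
              dotZ (fun e : Fin (pt n' k * pM n' k) => h.getD ((a * pK n' k + ρ) * pL n' k + e) false)
                (fun e : Fin (pt n' k * pM n' k) => v.getD (0 + e) false)) := by
  unfold matCore
  rw [Bool.and_eq_true, decide_eq_true_iff, Bool.or_eq_true, List.any_eq_true]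
  simp only [List.mem_range, Bool.or_eq_true, List.any_eq_true, sliceD_eq_ofFn, notInX_ofFn_iff,
    beq_iff_eq, List.ofFn_inj, dotB_ofFn_ne_iff]
  constructor
  · rintro ⟨hk, hrest⟩
    refine ⟨hk, ?_⟩
    rcases hrest with h1 | ⟨a, ha, h2⟩
    · exact Or.inl h1
    · refine Or.inr ⟨⟨a, ha⟩, ?_⟩
      rcases h2 with (h2 | h2) | ⟨ρ, hρ, h2⟩
      · exact Or.inl h2
      · exact Or.inr (Or.inl h2)
      · exact Or.inr (Or.inr ⟨⟨ρ, hρ⟩, h2⟩)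
  · rintro ⟨hk, hrest⟩
    refine ⟨hk, ?_⟩
    rcases hrest with h1 | ⟨a, h2⟩
    · exact Or.inl h1
    · refine Or.inr ⟨a, a.isLt, ?_⟩
      rcases h2 with h2 | h2 | ⟨ρ, h2⟩
      · exact Or.inl (Or.inl h2)
      · exact Or.inl (Or.inr h2)
      · exact Or.inr ⟨ρ, ρ.isLt, h2⟩

/-- The guard: instances with `k ≥ n'` are rejected whatever the strings. [folklore] -/
theorem matCore_eq_false_of_le {h v u : List Bool} (hk : n' ≤ k) : matCore Q n' k h v u = false := by
  unfold matCore
  rw [Bool.and_eq_false_iff]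
  exact Or.inl (decide_eq_false (not_lt.2 hk))

end Matrix

/-! ### Hashable ⟹ some `h` makes the matrix true for all `v, u` -/

section Completeness

variable (Q : List (List (List ℕ))) {n' k : ℕ}

/-- Reading a doubly tupled family back from its string. [folklore] -/
theorem getD_ofFn_tuple₂ {K₁ K₂ L : ℕ} (H : Fin K₁ → Fin K₂ → Fin L → Bool) (a : Fin K₁) (ρ : Fin K₂) (e : Fin L) :
    (List.ofFn (tupleEquiv (K₁ * K₂) L (tupleEquiv K₁ K₂ H))).getD ((a * K₂ + ρ) * L + e) false = H a ρ e := by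
  have h1 : (a : ℕ) * K₂ + ρ < K₁ * K₂ := blockIndex_lt ρ.isLt a.isLt
  have h2 : ((a : ℕ) * K₂ + ρ) * L + e < K₁ * K₂ * L := blockIndex_lt e.isLt h1
  rw [getD_ofFn _ _ h2]
  have : (⟨((a : ℕ) * K₂ + ρ) * L + e, h2⟩ : Fin (K₁ * K₂ * L)) = blkIx ⟨(a : ℕ) * K₂ + ρ, h1⟩ e :=
    Fin.ext (by simp [blkIx_val])
  rw [this, tupleEquiv_apply_blkIx]
  have : (⟨(a : ℕ) * K₂ + ρ, h1⟩ : Fin (K₁ * K₂)) = blkIx a ρ := Fin.ext (by simp [blkIx_val])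
  rw [this, tupleEquiv_apply_blkIx]

/-- Reading a tupled family back from its string. [folklore] -/
theorem getD_ofFn_tuple {K L : ℕ} (F : Fin K → Fin L → Bool) (c : Fin K) (e : Fin L) :
    (List.ofFn (tupleEquiv K L F)).getD (c * L + e) false = F c e := by
  have h2 : (c : ℕ) * L + e < K * L := blockIndex_lt e.isLt c.isLt
  rw [getD_ofFn _ _ h2]
  have : (⟨(c : ℕ) * L + e, h2⟩ : Fin (K * L)) = blkIx c e := Fin.ext (by simp [blkIx_val])
  rw [this, tupleEquiv_apply_blkIx]

/-- **Completeness**: if `S^t` is hashable at level `κ`, the string listing a separating family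
(`|h| = κ² L`) makes the matrix true for all `v, u` (given `k < n'`). [cite: Sipser1983, §V]
[cite: HanHemaspaandraThierauf1997, Thm. 3.11 (proof)] -/
theorem matCore_of_hashable (hk : k < n') (hH : Hashable (tuplePow (npSet Q n' k) (pt n' k)) (pK n' k)) :
    ∃ h : List Bool, h.length = pK n' k * pK n' k * pL n' k ∧ ∀ v u : List Bool, matCore Q n' k h v u = true := by
  classical
  obtain ⟨H, hSep⟩ := hH
  refine ⟨List.ofFn (tupleEquiv (pK n' k * pK n' k) (pL n' k) (tupleEquiv (pK n' k) (pK n' k) H)), by simp, ?_⟩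
  intro v u
  rw [matCore_eq_true_iff]
  refine ⟨hk, ?_⟩
  -- the decoded objects
  set y : Fin (pt n' k * pM n' k) → Bool := fun e => v.getD (0 + e) false with hy
  set Z : Fin (pK n' k) → Fin (pt n' k * pM n' k) → Bool := fun a e => v.getD ((a + 1) * pL n' k + e) false with hZ
  have hHrow : ∀ (a ρ : Fin (pK n' k)), (fun e : Fin (pt n' k * pM n' k) =>
      (List.ofFn (tupleEquiv (pK n' k * pK n' k) (pL n' k) (tupleEquiv (pK n' k) (pK n' k) H))).getD
        ((a * pK n' k + ρ) * pL n' k + e) false) = H a ρ := by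
    intro a ρ; funext e; exact getD_ofFn_tuple₂ H a ρ e
  simp only [hHrow]
  -- is `y` a genuine (unrefuted) member of `S^t`?
  by_cases hyX : y ∈ tuplePow (npSet Q n' k) (pt n' k)
  swap
  · -- some block of `y` lies outside `S`: the `u`-witness for it fails
    left
    rw [mem_tuplePow, not_forall] at hyX
    obtain ⟨j, hj⟩ := hyX
    refine ⟨j, ?_⟩
    rw [← exists_relOK_iff_mem_npSet] at hj
    cases hrel : relOK Q n' (pT n') (pN n') (pR n' k) (List.ofFn (blk y j))
        (List.ofFn fun e : Fin (pT n' * n') => u.getD ((0 * pt n' k + j) * pN n' + e) false)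
    · rfl
    · exact absurd ⟨_, hrel⟩ hj
  · by_cases hyref : ∃ j : Fin (pt n' k), relOK Q n' (pT n') (pN n') (pR n' k) (List.ofFn (blk y j))
        (List.ofFn fun e : Fin (pT n' * n') => u.getD ((0 * pt n' k + j) * pN n' + e) false) = false
    · exact Or.inl hyref
    right
    obtain ⟨a, ha⟩ := hSep y hyX
    refine ⟨a, ?_⟩
    by_cases hZX : Z a ∈ tuplePow (npSet Q n' k) (pt n' k)
    swap
    · left
      rw [mem_tuplePow, not_forall] at hZX
      obtain ⟨j, hj⟩ := hZX
      refine ⟨j, ?_⟩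
      rw [← exists_relOK_iff_mem_npSet] at hj
      cases hrel : relOK Q n' (pT n') (pN n') (pR n' k) (List.ofFn (blk (Z a) j))
          (List.ofFn fun e : Fin (pT n' * n') => u.getD (((a + 1) * pt n' k + j) * pN n' + e) false)
      · rfl
      · exact absurd ⟨_, hrel⟩ hj
    · by_cases hZy : Z a = y
      · exact Or.inr (Or.inl hZy)
      · right; right
        have hne : hashVal (H a) (Z a) ≠ hashVal (H a) y := ha (Z a) hZX hZy
        by_contra hall
        push Not at hall
        exact hne (funext fun ρ => hall ρ)

end Completeness

/-! ### Some `h` true for all short `v, u` ⟹ hashable -/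

section Soundness

variable (Q : List (List (List ℕ))) {n' k : ℕ}

/-- **Soundness**: if some `h` makes the matrix true for every challenge string `v` of length
`(κ+1)L` and every witness table `u` of length `(κ+1)·t·N`, then `S^t` is hashable at level `κ` (by
the family read off `h`). [cite: Sipser1983, §V] [cite: HanHemaspaandraThierauf1997, Thm. 3.11 (proof)] -/
theorem hashable_of_matCore (h : List Bool)
    (hall : ∀ v u : List Bool, v.length = (pK n' k + 1) * pL n' k → u.length = (pK n' k + 1) * pt n' k * pN n' →
      matCore Q n' k h v u = true) :
    Hashable (tuplePow (npSet Q n' k) (pt n' k)) (pK n' k) := by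
  classical
  -- the family read off `h`
  set H : Fin (pK n' k) → Fin (pK n' k) → Fin (pt n' k * pM n' k) → Bool :=
    fun a ρ e => h.getD ((a * pK n' k + ρ) * pL n' k + e) false with hHdef
  refine ⟨H, ?_⟩
  intro y hyX
  by_contra hiso
  push Not at hiso
  -- for every matrix a collider `z a ∈ S^t`, `z a ≠ y`, same hash value
  have hz : ∀ a : Fin (pK n' k), ∃ z : Fin (pt n' k * pM n' k) → Bool,
      z ∈ tuplePow (npSet Q n' k) (pt n' k) ∧ z ≠ y ∧ hashVal (H a) z = hashVal (H a) y := by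
    intro a
    have := hiso a
    simp only [Isolates, not_forall, exists_prop, not_not] at this
    obtain ⟨z, hz, hne, heq⟩ := this
    exact ⟨z, hz, hne, heq⟩
  choose z hzX hzy hzH using hz
  -- the sides `side 0 = y`, `side (a+1) = z a`, and membership witnesses for all their blocks
  set side : Fin (pK n' k + 1) → Fin (pt n' k * pM n' k) → Bool := Fin.cons y z with hside
  have hsideX : ∀ c, side c ∈ tuplePow (npSet Q n' k) (pt n' k) := by
    intro c
    refine Fin.cases ?_ (fun a => ?_) c
    · simpa [hside] using hyX
    · simpa [hside] using hzX a
  have hwit : ∀ (c : Fin (pK n' k + 1)) (j : Fin (pt n' k)), ∃ w : Fin (pT n' * n') → Bool,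
      relOK Q n' (pT n') (pN n') (pR n' k) (List.ofFn (blk (side c) j)) (List.ofFn w) = true :=
    fun c j => (exists_relOK_iff_mem_npSet Q n' k _).2 (mem_tuplePow.1 (hsideX c) j)
  choose w hw using hwit
  -- the strings
  set v := List.ofFn (tupleEquiv (pK n' k + 1) (pL n' k) side) with hv
  set u := List.ofFn (tupleEquiv ((pK n' k + 1) * pt n' k) (pN n') (tupleEquiv (pK n' k + 1) (pt n' k) w)) with hu
  have hvlen : v.length = (pK n' k + 1) * pL n' k := by simp [hv]
  have hulen : u.length = (pK n' k + 1) * pt n' k * pN n' := by simp [hu]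
  -- decoding them
  have hdec_y : (fun e : Fin (pt n' k * pM n' k) => v.getD (0 + e) false) = y := by
    funext e
    have := getD_ofFn_tuple (tupleEquiv (pK n' k + 1) (pL n' k) side |> fun _ => side) (0 : Fin (pK n' k + 1)) e
    rw [hv, show (0 : ℕ) + e = (0 : Fin (pK n' k + 1)) * pL n' k + e by simp, getD_ofFn_tuple]
    simp [hside]
  have hdec_Z : ∀ a : Fin (pK n' k), (fun e : Fin (pt n' k * pM n' k) => v.getD ((a + 1) * pL n' k + e) false) = z a := by
    intro a; funext e
    rw [hv, show ((a : ℕ) + 1) * pL n' k + e = (a.succ : Fin (pK n' k + 1)) * pL n' k + e by simp, getD_ofFn_tuple]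
    simp [hside]
  have hdec_w : ∀ (c : Fin (pK n' k + 1)) (j : Fin (pt n' k)),
      (fun e : Fin (pT n' * n') => u.getD ((c * pt n' k + j) * pN n' + e) false) = w c j := by
    intro c j; funext e
    rw [hu]
    exact getD_ofFn_tuple₂ w c j e
  -- the matrix is false on `(h, v, u)`
  have hfalse : ¬ matCore Q n' k h v u = true := by
    rw [matCore_eq_true_iff]
    rintro ⟨-, hrest⟩
    rcases hrest with ⟨j, hj⟩ | ⟨a, ha⟩
    · rw [hdec_y, show ((0 : ℕ) * pt n' k + (j : ℕ)) = ((0 : Fin (pK n' k + 1)) : ℕ) * pt n' k + j by simp] at hj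
      rw [hdec_w 0 j] at hj
      have := hw 0 j
      simp only [hside, Fin.cons_zero] at this
      rw [this] at hj
      exact Bool.noConfusion hj
    · rw [hdec_Z a, hdec_y] at ha
      rcases ha with ⟨j, hj⟩ | hZy | ⟨ρ, hρ⟩
      · rw [show (((a : ℕ) + 1) * pt n' k + (j : ℕ)) = ((a.succ : Fin (pK n' k + 1)) : ℕ) * pt n' k + j by simp,
          hdec_w a.succ j] at hj
        have := hw a.succ j
        simp only [hside, Fin.cons_succ] at this
        rw [this] at hj
        exact Bool.noConfusion hj
      · exact hzy a hZy
      · exact hρ (congrFun (hzH a) ρ)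
  exact hfalse (hall v u hvlen hulen)

end Soundness

end PEAHash

end Literature.Computability.Complexity
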